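import Literature.NumberTheory.LFunctions.WeilFirstPrimeOddMarginAKappa
import Literature.NumberTheory.LFunctions.WeilFirstPrimeCertificateCCheck
import Literature.NumberTheory.LFunctions.WeilFirstPrimeCertificateCBlock1
import Literature.NumberTheory.LFunctions.WeilFirstPrimeOddMarginARows0
import Literature.NumberTheory.LFunctions.WeilFirstPrimeOddMarginARows1
import Literature.NumberTheory.LFunctions.WeilFirstPrimeOddMarginARows2
import Literature.NumberTheory.LFunctions.WeilFirstPrimeOddMarginARows3
import Literature.NumberTheory.LFunctions.WeilFirstPrimeOddMarginARows4
import Literature.NumberTheory.LFunctions.WeilFirstPrimeOddMarginARows5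
import Literature.NumberTheory.LFunctions.WeilFirstPrimeOddMarginARows6
import Literature.NumberTheory.LFunctions.WeilFirstPrimeOddMarginARows7
import Literature.NumberTheory.LFunctions.WeilFirstPrimeOddMarginARows8
import Literature.NumberTheory.LFunctions.WeilFirstPrimeOddMarginARows9
import Literature.NumberTheory.LFunctions.WeilFirstPrimeOddMarginANu0
import Literature.NumberTheory.LFunctions.WeilFirstPrimeOddMarginANu1
import Literature.NumberTheory.LFunctions.WeilFirstPrimeOddMarginANu2
import Literature.NumberTheory.LFunctions.WeilFirstPrimeOddMarginANu3
import HarnessLib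

/-!
# Odd-sector margin certificate A: assembly of the checks

`weilCertOddA` passes the cell check and the moment check (both LITERALLY those of `weilCert3C` up to the rescaling of the table, `…ANu*.lean`), the scalar
side conditions, and its ODD block passes `WeilCert.checkBlockK` at the lowered Bessel coefficient
`κ' = weilCertOddAKappa'` (`D C = I` rows: those of `weilCert3C`, definitionally; dominance rows: the sibling
`…ARows*.lean` files; `WeilCert.checkBlockK_of_rows`). These Booleans are what the odd-margin soundness
theorem consumes. Pure proof file; nothing is asserted.
-/

noncomputable section

namespace Literature.NumberTheory.LFunctions

/-- **Kernel check of the cells** of certificate A (= the Stage-C cells check, same level, cut-off and cells). [folklore] -/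
theorem checkCells_weilCertOddA :
    checkCells₃ weilCertOddA.base.prec weilCertOddA.j weilCertOddA.base.wL weilCertOddA.base.T weilCertOddA.base.mwT weilCertOddA.cells = true :=
  checkCells_weilCert3C

/-- **The moment table of certificate A is correct** (even entries `q ≤ 198`). [folklore] -/
theorem checkNu_weilCertOddA : weilCertOddA.checkNu = true := by
  refine WeilCert2.allBelow_of_forall fun k hk ↦ ?_
  have hk' : k < 100 := hk
  interval_cases k
  · exact checkNuAt0_weilCertOddA
  · exact checkNuAt2_weilCertOddA
  · exact checkNuAt4_weilCertOddA
  · exact checkNuAt6_weilCertOddA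
  · exact checkNuAt8_weilCertOddA
  · exact checkNuAt10_weilCertOddA
  · exact checkNuAt12_weilCertOddA
  · exact checkNuAt14_weilCertOddA
  · exact checkNuAt16_weilCertOddA
  · exact checkNuAt18_weilCertOddA
  · exact checkNuAt20_weilCertOddA
  · exact checkNuAt22_weilCertOddA
  · exact checkNuAt24_weilCertOddA
  · exact checkNuAt26_weilCertOddA
  · exact checkNuAt28_weilCertOddA
  · exact checkNuAt30_weilCertOddA
  · exact checkNuAt32_weilCertOddA
  · exact checkNuAt34_weilCertOddA
  · exact checkNuAt36_weilCertOddA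
  · exact checkNuAt38_weilCertOddA
  · exact checkNuAt40_weilCertOddA
  · exact checkNuAt42_weilCertOddA
  · exact checkNuAt44_weilCertOddA
  · exact checkNuAt46_weilCertOddA
  · exact checkNuAt48_weilCertOddA
  · exact checkNuAt50_weilCertOddA
  · exact checkNuAt52_weilCertOddA
  · exact checkNuAt54_weilCertOddA
  · exact checkNuAt56_weilCertOddA
  · exact checkNuAt58_weilCertOddA
  · exact checkNuAt60_weilCertOddA
  · exact checkNuAt62_weilCertOddA
  · exact checkNuAt64_weilCertOddA
  · exact checkNuAt66_weilCertOddA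
  · exact checkNuAt68_weilCertOddA
  · exact checkNuAt70_weilCertOddA
  · exact checkNuAt72_weilCertOddA
  · exact checkNuAt74_weilCertOddA
  · exact checkNuAt76_weilCertOddA
  · exact checkNuAt78_weilCertOddA
  · exact checkNuAt80_weilCertOddA
  · exact checkNuAt82_weilCertOddA
  · exact checkNuAt84_weilCertOddA
  · exact checkNuAt86_weilCertOddA
  · exact checkNuAt88_weilCertOddA
  · exact checkNuAt90_weilCertOddA
  · exact checkNuAt92_weilCertOddA
  · exact checkNuAt94_weilCertOddA
  · exact checkNuAt96_weilCertOddA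
  · exact checkNuAt98_weilCertOddA
  · exact checkNuAt100_weilCertOddA
  · exact checkNuAt102_weilCertOddA
  · exact checkNuAt104_weilCertOddA
  · exact checkNuAt106_weilCertOddA
  · exact checkNuAt108_weilCertOddA
  · exact checkNuAt110_weilCertOddA
  · exact checkNuAt112_weilCertOddA
  · exact checkNuAt114_weilCertOddA
  · exact checkNuAt116_weilCertOddA
  · exact checkNuAt118_weilCertOddA
  · exact checkNuAt120_weilCertOddA
  · exact checkNuAt122_weilCertOddA
  · exact checkNuAt124_weilCertOddA
  · exact checkNuAt126_weilCertOddA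
  · exact checkNuAt128_weilCertOddA
  · exact checkNuAt130_weilCertOddA
  · exact checkNuAt132_weilCertOddA
  · exact checkNuAt134_weilCertOddA
  · exact checkNuAt136_weilCertOddA
  · exact checkNuAt138_weilCertOddA
  · exact checkNuAt140_weilCertOddA
  · exact checkNuAt142_weilCertOddA
  · exact checkNuAt144_weilCertOddA
  · exact checkNuAt146_weilCertOddA
  · exact checkNuAt148_weilCertOddA
  · exact checkNuAt150_weilCertOddA
  · exact checkNuAt152_weilCertOddA
  · exact checkNuAt154_weilCertOddA
  · exact checkNuAt156_weilCertOddA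
  · exact checkNuAt158_weilCertOddA
  · exact checkNuAt160_weilCertOddA
  · exact checkNuAt162_weilCertOddA
  · exact checkNuAt164_weilCertOddA
  · exact checkNuAt166_weilCertOddA
  · exact checkNuAt168_weilCertOddA
  · exact checkNuAt170_weilCertOddA
  · exact checkNuAt172_weilCertOddA
  · exact checkNuAt174_weilCertOddA
  · exact checkNuAt176_weilCertOddA
  · exact checkNuAt178_weilCertOddA
  · exact checkNuAt180_weilCertOddA
  · exact checkNuAt182_weilCertOddA
  · exact checkNuAt184_weilCertOddA
  · exact checkNuAt186_weilCertOddA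
  · exact checkNuAt188_weilCertOddA
  · exact checkNuAt190_weilCertOddA
  · exact checkNuAt192_weilCertOddA
  · exact checkNuAt194_weilCertOddA
  · exact checkNuAt196_weilCertOddA
  · exact checkNuAt198_weilCertOddA

/-- **The odd block of certificate A passes `checkBlockK` at `κ'`.** [folklore] -/
theorem checkBlock1_weilCertOddA : weilCertOddA.base.checkBlockK weilCertOddA.nuTab weilCertOddAKappa' 1 = true := by
  refine WeilCert.checkBlockK_of_rows (fun i hi ↦ ?_) (fun i hi ↦ ?_)
  · have hi' : i < 50 := hi
    interval_cases i
    · exact checkDCRow1_0_weilCert3C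
    · exact checkDCRow1_1_weilCert3C
    · exact checkDCRow1_2_weilCert3C
    · exact checkDCRow1_3_weilCert3C
    · exact checkDCRow1_4_weilCert3C
    · exact checkDCRow1_5_weilCert3C
    · exact checkDCRow1_6_weilCert3C
    · exact checkDCRow1_7_weilCert3C
    · exact checkDCRow1_8_weilCert3C
    · exact checkDCRow1_9_weilCert3C
    · exact checkDCRow1_10_weilCert3C
    · exact checkDCRow1_11_weilCert3C
    · exact checkDCRow1_12_weilCert3C
    · exact checkDCRow1_13_weilCert3C
    · exact checkDCRow1_14_weilCert3C
    · exact checkDCRow1_15_weilCert3C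
    · exact checkDCRow1_16_weilCert3C
    · exact checkDCRow1_17_weilCert3C
    · exact checkDCRow1_18_weilCert3C
    · exact checkDCRow1_19_weilCert3C
    · exact checkDCRow1_20_weilCert3C
    · exact checkDCRow1_21_weilCert3C
    · exact checkDCRow1_22_weilCert3C
    · exact checkDCRow1_23_weilCert3C
    · exact checkDCRow1_24_weilCert3C
    · exact checkDCRow1_25_weilCert3C
    · exact checkDCRow1_26_weilCert3C
    · exact checkDCRow1_27_weilCert3C
    · exact checkDCRow1_28_weilCert3C
    · exact checkDCRow1_29_weilCert3C
    · exact checkDCRow1_30_weilCert3C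
    · exact checkDCRow1_31_weilCert3C
    · exact checkDCRow1_32_weilCert3C
    · exact checkDCRow1_33_weilCert3C
    · exact checkDCRow1_34_weilCert3C
    · exact checkDCRow1_35_weilCert3C
    · exact checkDCRow1_36_weilCert3C
    · exact checkDCRow1_37_weilCert3C
    · exact checkDCRow1_38_weilCert3C
    · exact checkDCRow1_39_weilCert3C
    · exact checkDCRow1_40_weilCert3C
    · exact checkDCRow1_41_weilCert3C
    · exact checkDCRow1_42_weilCert3C
    · exact checkDCRow1_43_weilCert3C
    · exact checkDCRow1_44_weilCert3C
    · exact checkDCRow1_45_weilCert3C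
    · exact checkDCRow1_46_weilCert3C
    · exact checkDCRow1_47_weilCert3C
    · exact checkDCRow1_48_weilCert3C
    · exact checkDCRow1_49_weilCert3C
  · have hi' : i < 50 := hi
    interval_cases i
    · exact checkDomRow1_0_weilCertOddA
    · exact checkDomRow1_1_weilCertOddA
    · exact checkDomRow1_2_weilCertOddA
    · exact checkDomRow1_3_weilCertOddA
    · exact checkDomRow1_4_weilCertOddA
    · exact checkDomRow1_5_weilCertOddA
    · exact checkDomRow1_6_weilCertOddA
    · exact checkDomRow1_7_weilCertOddA
    · exact checkDomRow1_8_weilCertOddA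
    · exact checkDomRow1_9_weilCertOddA
    · exact checkDomRow1_10_weilCertOddA
    · exact checkDomRow1_11_weilCertOddA
    · exact checkDomRow1_12_weilCertOddA
    · exact checkDomRow1_13_weilCertOddA
    · exact checkDomRow1_14_weilCertOddA
    · exact checkDomRow1_15_weilCertOddA
    · exact checkDomRow1_16_weilCertOddA
    · exact checkDomRow1_17_weilCertOddA
    · exact checkDomRow1_18_weilCertOddA
    · exact checkDomRow1_19_weilCertOddA
    · exact checkDomRow1_20_weilCertOddA
    · exact checkDomRow1_21_weilCertOddA
    · exact checkDomRow1_22_weilCertOddA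
    · exact checkDomRow1_23_weilCertOddA
    · exact checkDomRow1_24_weilCertOddA
    · exact checkDomRow1_25_weilCertOddA
    · exact checkDomRow1_26_weilCertOddA
    · exact checkDomRow1_27_weilCertOddA
    · exact checkDomRow1_28_weilCertOddA
    · exact checkDomRow1_29_weilCertOddA
    · exact checkDomRow1_30_weilCertOddA
    · exact checkDomRow1_31_weilCertOddA
    · exact checkDomRow1_32_weilCertOddA
    · exact checkDomRow1_33_weilCertOddA
    · exact checkDomRow1_34_weilCertOddA
    · exact checkDomRow1_35_weilCertOddA
    · exact checkDomRow1_36_weilCertOddA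
    · exact checkDomRow1_37_weilCertOddA
    · exact checkDomRow1_38_weilCertOddA
    · exact checkDomRow1_39_weilCertOddA
    · exact checkDomRow1_40_weilCertOddA
    · exact checkDomRow1_41_weilCertOddA
    · exact checkDomRow1_42_weilCertOddA
    · exact checkDomRow1_43_weilCertOddA
    · exact checkDomRow1_44_weilCertOddA
    · exact checkDomRow1_45_weilCertOddA
    · exact checkDomRow1_46_weilCertOddA
    · exact checkDomRow1_47_weilCertOddA
    · exact checkDomRow1_48_weilCertOddA
    · exact checkDomRow1_49_weilCertOddA

end Literature.NumberTheory.LFunctions
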